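import Summits.BirchSwinnertonDyer.BirchSwinnertonDyer.Theses.SignedBaseChange
import Summits.BirchSwinnertonDyer.BirchSwinnertonDyer.Theorems.SignedBaseChangeAnticyclotomicEisensteinDivisibilityXAcTorsionTransfer
import Summits.BirchSwinnertonDyer.BirchSwinnertonDyer.Theorems.SignedBaseChangeAnticyclotomicEisensteinDivisibilityXAcTorsionSignedCarrier
import Summits.BirchSwinnertonDyer.BirchSwinnertonDyer.Theorems.SignedBaseChangeAnticyclotomicEisensteinDivisibilityXAcTorsionSignedRank
import Summits.BirchSwinnertonDyer.BirchSwinnertonDyer.Theorems.SignedBaseChangeAnticyclotomicEisensteinDivisibilityAnticyclotomicNonsplit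
import Summits.BirchSwinnertonDyer.BirchSwinnertonDyer.Theorems.UniversalToricDescentSignedSettingNoPTorsion
import Summits.BirchSwinnertonDyer.BirchSwinnertonDyer.Theorems.UniversalToricDescentTwinFullThreeAdicImageOverK
import Summits.BirchSwinnertonDyer.BirchSwinnertonDyer.Theorems.EisensteinPrimesTwistDeformationFullAtSelmerOfFacts
import Literature.NumberTheory.EllipticCurves.AnticyclotomicSignedTransferInputs
import Literature.NumberTheory.EllipticCurves.BSDSelmerPConverseSerreProofs
import Literature.NumberTheory.EllipticCurves.ZywinaCMImageProofs
import Literature.NumberTheory.EllipticCurves.HeightConductorBoundsModularityProofs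
import Literature.NumberTheory.EllipticCurves.YanZhu2026.GreenbergMainTheoremsAnyRoot
import HarnessLib

/-!
# Stub (a) `stub_xAcTorsionSS` of line `bdpline` (crux `AnticyclotomicEisensteinDivisibility`,
# stmt-BirchSwinnertonDyer-20727) CLOSED MODULO TWO REFEREED TYPED FACTS and ONE extra binder:
# `X_ac = X_Gr(E/K_∞⁻)` is `Λ`-torsion at a good supersingular prime, from Longo–Vigni 2019 Thm. 1.4
# (rank one of `X^±`) and Castella–Wan 2024 Thm. 6.8 (the transfer), given `p ∤ h_K`

Width seat bsd-line-sbc-p1-w4 (gen 0), `--supports stmt-BirchSwinnertonDyer-20727`. The registered stub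
`stub_xAcTorsionSS` (ONE-variable torsion of `AcSelmer.XAc (W.baseChange K) p κ₂ v̄ ∅ γ₂` at a good
supersingular `p ≥ 5`, `Surj`, classical Heegner `K`, ANY conductor) was PRINT "modulo the PRE binder
CCSS18" (`…XAcTorsionOfCCSS`, p618123) and its refereed form was booked as "Castella–Wan Math. Ann. L5.11 /
T5.12". CENSUS CORRECTION: those numbers are arXiv v2 (2018) of 1607.02019; the REFEREED journal text
(Math. Ann. 389 (2024), authors' MS) replaces them by Thm. A.5, which ASSUMES `N` SQUARE-FREE (for the big
image input [Edi97]) and so does NOT reach additive conductor. The refereed rank-one input that does is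
Longo–Vigni, Boll. UMI 12 (2019) Thm. 1.4 (typed: `AcSigned.longoVigni2019_thm14_signedSelmerDual_rank_one`:
any `N` with `N⁻ = 1`, `p ≥ 5`, `ρ_{E,p}` onto, Assumption 1.3 ⟸ `p ∤ h_K`), and the transfer
"rank `X_ε = 1` ⟹ `X^{rel,str}` torsion" is Castella–Wan's proof of Thm. 6.8 (typed inputs:
`AcSigned.castellaWan2024_proofThm68_transferInputs`, any `N`, `p > 3`; module algebra PROVED in the tree).
This file ASSEMBLES: the registered text of `stub_xAcTorsionSS`, VERBATIM, with ONE extra binder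
`¬ p ∣ NumberField.classNumber K` (the `Setting`'s printed sufficient condition for total ramification above
`p`; = the lead's gen-2 recommendation to the planner), modulo the two facts as hypotheses. Everything else
is kernel-proved: the torsion-only transfer (`…XAcTorsionTransfer`, p628651), the identity of the two
transcriptions of the signed Selmer group (`…XAcTorsionSignedCarrier{Local,}`, p631203 / p632262), the rank
transport to Kobayashi's dual (`…XAcTorsionSignedRank`, p631478), total non-splitting above `p` from
`p ∤ h_K` (`…AnticyclotomicNonsplit`, p632042), `E(K_{∞,w})[p^∞] = 0` (tree,
`fixedPoints_decomp_inf_kerSubgroup_geomPrimaryTorsion_eq_bot_of_setting`), the big `p`-adic image from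
`Surj` at `p ≥ 5` (Serre, tree `serre_hasSurjectiveModNGaloisRep_pow_holds` +
`mem_range_galoisRepTate_of_forall_hasSurjectiveModNGaloisRep`), no CM from `Surj` (Zywina, tree), `N ≥ 11`
(tree `eleven_le_conductorNorm_of_modularity`). So (a) is REFEREED-PRINT modulo typed facts on the sub-leaf
`p ∤ h_K`; the stub AS REGISTERED (no class-number binder) is not closed by this file
(⇒ `stub-misstated`: add the binder, or supply total ramification otherwise). BSD / the crux / the summit
statement are NOT proved by this file.

References: [LongoVigni2019] Thm. 1.4, Assumptions 1.1–1.3 (arXiv:1503.07812 p. 3); [CastellaWan2023]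
Thm. 6.8 and its proof (MS pp. 29–31), Thm. A.5 (MS p. 35); [HatleyLeiVigni2022] §1.1; [Kobayashi2003]
Def. 1.1; [BDKim2013] Prop. 3.2; [Brink2007] Cor. 1.
-/

-- D-0017: single-problem summit, the namespace repeats the problem name by design.
set_option linter.dupNamespace false
set_option autoImplicit false

noncomputable section

open scoped Classical

namespace Summit.BirchSwinnertonDyer.BirchSwinnertonDyer.Theorems.SignedBaseChangeAcDivXAcTorsionOfLongoVigni

open Summit.BirchSwinnertonDyer.BirchSwinnertonDyer.Theses.SignedBaseChange
open NumberField IsDedekindDomain Field CongruenceSubgroup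
  Literature.NumberTheory.EllipticCurves Literature.NumberTheory.EllipticCurves.ModularForms
  Literature.NumberTheory.EllipticCurves.Rank1Residual Literature.NumberTheory.EllipticCurves.YanZhu2026
  Literature.NumberTheory.EllipticCurves.AcSigned Literature.NumberTheory.EllipticCurves.Kobayashi2003
  Literature.NumberTheory.GaloisRepresentations
  Summit.BirchSwinnertonDyer.BirchSwinnertonDyer.Theorems

/-- **Stub (a) `stub_xAcTorsionSS` — its registered text with ONE extra binder `¬ p ∣ h_K`, modulo the
two REFEREED typed facts** `AcSigned.longoVigni2019_thm14_signedSelmerDual_rank_one` (Longo–Vigni 2019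
Thm. 1.4: `X^ε` of `Λ`-rank one) and `AcSigned.castellaWan2024_proofThm68_transferInputs` (Castella–Wan
2024, the inputs of the proof of Thm. 6.8), both at the place `v` induced by `ι` (relaxed) with `v̄` the
strict place: **`X_ac = AcSelmer.XAc (W⁄K) p κ₂ v̄ ∅ γ₂` is a torsion `Λ`-module.** Assembly: `Setting`
from the crux binders and `p ∤ h_K`; `IsNonsplitIn κ₂ v` and the local generator from total non-splitting;
the sign `ε = +`; `TransferInputs` from the Castella–Wan fact; `rank X_+ = 1` from Longo–Vigni on
Kobayashi's dual, transported to Kim's carrier by the identity of the two signed Selmer groups (which uses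
`E(K_{∞,w})[p^∞] = 0` at both `w ∣ p`); then the torsion-only transfer.
[cite: LongoVigni2019, Thm. 1.4 and Assumptions 1.1–1.3 (arXiv:1503.07812 p. 3)]
[cite: CastellaWan2023, Thm. 6.8 and its proof (MS pp. 29–31)] [cite: HatleyLeiVigni2022, §1.1] -/
theorem xAcTorsionSS_of_longoVigni_castellaWan
    (hLV : ∀ (W : WeierstrassCurve ℚ) [W.IsGloballyMinimal] (K : Type) [Field K] [NumberField K]
      (p : ℕ) [Fact p.Prime] (κ : ZpExtension K p) (𝔭 𝔭' : HeightOneSpectrum (𝓞 K)),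
      longoVigni2019_thm14_signedSelmerDual_rank_one W K p κ 𝔭 𝔭')
    (hCW : ∀ (N : ℕ) [NeZero N] (W : WeierstrassCurve ℚ) [W.IsGloballyMinimal] (K : Type) [Field K]
      [NumberField K] (p : ℕ) [Fact p.Prime] (κ : ZpExtension K p) (𝔭 𝔭' : HeightOneSpectrum (𝓞 K)),
      castellaWan2024_proofThm68_transferInputs N W K p κ 𝔭 𝔭') :
    SignedTwoVariableInputs → Literature.NumberTheory.EllipticCurves.ModularForms.nonempty_modularParametrizationData → ∀ (W : WeierstrassCurve ℚ) [W.IsElliptic] [W.IsGloballyMinimal] (p : ℕ) [Fact p.Prime], 5 ≤ p → W.HasGoodReductionAtPrime p → W.frobeniusTrace p = 0 → Literature.NumberTheory.EllipticCurves.Rank1Residual.Surj W p → ∀ (K : Type) [Field K] [NumberField K] (ι : PadicAlgCl p ≃+* ℂ) (v vbar : IsDedekindDomain.HeightOneSpectrum (NumberField.RingOfIntegers K)) (κ₁ κ₂ : Literature.NumberTheory.EllipticCurves.ZpExtension K p) (γ₁ γ₂ : Field.absoluteGaloisGroup K) [Fact (Literature.NumberTheory.EllipticCurves.ZpExtension.IsTopGeneratorPair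 κ₁ κ₂ γ₁ γ₂)] [NeZero (NumberField.discr K).natAbs] (N : ℕ) [NeZero N] (f : CuspForm (CongruenceSubgroup.Gamma0 N) 2), Literature.NumberTheory.EllipticCurves.ModularForms.IsNewformOf W f → (N : ℤ) = W.conductorNorm ℤ → Literature.NumberTheory.EllipticCurves.IsImaginaryQuadratic K → ((Ideal.span {(p : ℤ)}).primesOver (NumberField.RingOfIntegers K)).ncard = 2 → ((p : ℕ) : NumberField.RingOfIntegers K) ∈ v.asIdeal → ((p : ℕ) : NumberField.RingOfIntegers K) ∈ vbar.asIdeal → vbar ≠ v → (∀ (w : NumberField.InfinitePlace K) (k : NumberField.RingOfIntegers K), k ∈ v.asIdeal ↔ ‖ι.symm (w.embedding (k : K))‖ < 1) → IsCoprime (N : ℤ) (NumberField.discr K) → (∀ ℓ : ℕ, ℓ.Prime → ℓ ∣ N → ((Ideal.span {(ℓ : ℤ)}).primesOver (NumberField.RingOfIntegers K)).ncard = 2) → Odd (NumberField.discr K) → NumberField.discr K ≠ -3 → κ₁.IsCyclotomic → κ₂.IsAnticyclotomic → ¬ p ∣ NumberField.classNumber K → (haveI : Fact (κ₂.IsTopGenerator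 γ₂) := ⟨Literature.NumberTheory.EllipticCurves.YanZhu2026.isTopGenerator_of_pair (κ₁ := κ₁) (γ₁ := γ₁)⟩; Module.IsTorsion (Literature.NumberTheory.EllipticCurves.IwasawaAlgebra p) (Literature.NumberTheory.EllipticCurves.Castella2018.AcSelmer.XAc (W.baseChange K) p κ₂ vbar ∅ γ₂)) := by
  intro _ hmodP W _ _ p _ hp hgood ha0 hs K _ _ ι v vbar κ₁ κ₂ γ₁ γ₂ _ _ N _ f hf hN hK hsplit hv hvbar hvv
    hι _ hHeeg _ _ _ hκ₂ hh
  haveI hγF : Fact (κ₂.IsTopGenerator γ₂) := ⟨isTopGenerator_of_pair (κ₁ := κ₁) (γ₁ := γ₁)⟩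
  have hprime : p.Prime := Fact.out
  have hp2 : p ≠ 2 := by omega
  haveI : (W.baseChange K).IsElliptic := by rw [WeierstrassCurve.baseChange]; infer_instance
  -- the `Setting` of the anticyclotomic signed theory (with `p ∤ h_K`)
  have hS : AcSigned.Setting W K p κ₂ v vbar :=
    ⟨inferInstance, hp2, ⟨hgood, by rw [ha0]; exact dvd_zero _⟩, ha0, hK, hv, hvbar, hvv, hκ₂, hh⟩
  have hS' : AcSigned.Setting W K p κ₂ vbar v :=
    ⟨inferInstance, hp2, ⟨hgood, by rw [ha0]; exact dvd_zero _⟩, ha0, hK, hvbar, hv, hvv.symm, hκ₂, hh⟩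
  -- the conductor and the Heegner hypothesis in the facts' currency
  have h11 : 11 ≤ W.conductorNorm ℤ := eleven_le_conductorNorm_of_modularity hmodP W
  have hN' : (W.conductorNorm ℤ : ℕ) = N := by exact_mod_cast hN.symm
  have h3N : 3 < N := by rw [← hN']; omega
  have hHg : SatisfiesHeegnerHypothesis N K := fun ℓ hℓ hℓN ↦ hHeeg ℓ hℓ hℓN
  -- no CM and the big `p`-adic image from `Surj` at `p ≥ 5`
  have hCM : ¬ W.HasCM := fun hCM ↦ W.not_hasSurjectiveModNGaloisRep_of_hasCM hCM hprime hp2 hs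
  have hbig : ∀ u : Module.End ℤ_[p] (W.tateModule p), IsUnit u → u ∈ Set.range (W.galoisRepTate p) :=
    fun u hu ↦ ThreeAdicImageOverK.mem_range_galoisRepTate_of_forall_hasSurjectiveModNGaloisRep W p
      (serre_hasSurjectiveModNGaloisRep_pow_holds W p hp hs) u hu
  -- total non-splitting above `p` (from `p ∤ h_K`) and a local generator matching `γ₂`
  have h𝔭 : AcSigned.IsNonsplitIn κ₂ v :=
    SignedBaseChangeAcDivAnticyclotomicNonsplit.isNonsplitIn_of_isAnticyclotomic_of_not_dvd_classNumber
      hK hp2 κ₂ hκ₂ hh hv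
  obtain ⟨γ𝔭, hγ𝔭⟩ : ∃ γ𝔭 : absoluteGaloisGroup (v.adicCompletion K),
      κ₂ (resGalOfEmb (closureEmb (K := K) (v.adicCompletion K)) γ𝔭) = κ₂ γ₂ := h𝔭 (κ₂ γ₂)
  -- Castella–Wan's inputs of the proof of Thm. 6.8, at the sign `+`
  obtain ⟨ΩK, Ωp, L, -, -, hε⟩ := hCW N W K p κ₂ v vbar hS ι hf hN' hHg (by omega) hι γ₂ hγF.out h𝔭 γ𝔭 hγ𝔭
  obtain ⟨z, hT⟩ := hε 1
  -- `E(K_{∞,w})[p^∞] = 0` at both primes above `p`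
  have hNT : ∀ w : HeightOneSpectrum (𝓞 K), ((p : ℕ) : 𝓞 K) ∈ w.asIdeal →
      FixedPoints.addSubgroup ↥(GreenbergSelmer.decomp w ⊓ κ₂.kerSubgroup)
        ((W.baseChange K).geomPrimaryTorsion p) = ⊥ := by
    intro w hw
    rcases GreenbergFullAtSelmer.eq_or_eq_of_natCast_mem_of_ne hK.1 hv hvbar hvv hw with rfl | rfl
    · exact UniversalToricDescentSignedSetting.fixedPoints_decomp_inf_kerSubgroup_geomPrimaryTorsion_eq_bot_of_setting
        W K p κ₂ _ vbar hS
    · exact UniversalToricDescentSignedSetting.fixedPoints_decomp_inf_kerSubgroup_geomPrimaryTorsion_eq_bot_of_setting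
        W K p κ₂ _ v hS'
  -- the identity of the two signed Selmer groups, Longo–Vigni's rank one on Kobayashi's dual, transported
  have heq := SignedBaseChangeAcDivXAcTorsionCarrier.selmer_sgn_eq_signedSelmerInfty (W.baseChange K) κ₂
    hp2 1 hNT
  have hD := hLV W K p κ₂ v vbar hS N hN' h3N hHg hp hCM hbig γ₂ hγF.out 1
    (signedSelmerDualData (W.baseChange K) κ₂ 1 hγF.out)
  have hX : X.HasRank (W.baseChange K) p κ₂ ∅ (fun _ ↦ .sgn 1) hγF.out 1 :=
    SignedBaseChangeAcDivXAcTorsionCarrier.X.hasRank_sgn_of_signedSelmerDual (W.baseChange K) p κ₂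
      hγF.out 1 heq hD
  -- the torsion-only transfer
  exact SignedBaseChangeAcDivXAcTorsionTransfer.TransferInputs.isTorsion_XAc_of_hasRank hT hvbar hX

end Summit.BirchSwinnertonDyer.BirchSwinnertonDyer.Theorems.SignedBaseChangeAcDivXAcTorsionOfLongoVigni

end
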